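import Summits.BirchSwinnertonDyer.BirchSwinnertonDyer.Theses.RamifiedHeegnerPair
import Summits.BirchSwinnertonDyer.BirchSwinnertonDyer.Theorems.RamifiedHeegnerPairGss2LowerAtThreeRankOneMcCallumRoad
import Summits.BirchSwinnertonDyer.Rank1Residual.Additive.X4ExoticThree
import Literature.NumberTheory.EllipticCurves.NonEisensteinPrimeOfSurjective
import Summits.BirchSwinnertonDyer.Rank1Residual.Additive.LocIrrOddPrimes
import Summits.BirchSwinnertonDyer.Rank1Residual.GaloisImage.SupersingularTwistExactImage
import Summits.BirchSwinnertonDyer.Rank1Residual.GaloisImage.SmallImageInertiaOrder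
import Literature.Barriers.BirchSwinnertonDyer.EulerSystemBigImageAtSmallImage
import HarnessLib

/-!
# Route `RamifiedHeegnerPair` — the 3-adic TOWER is AUTOMATIC on the (G) cell at `3`:
# `Addv W 3 ∧ SubGord W 3 ∧ ρ̄_{E,3} onto ⟹ ρ̄_{E,3ⁿ} onto ∀ n`, so the declared residual NT
# `Gss2LowerAtThreeRankOneNonTower` (stmt-BirchSwinnertonDyer-27201) IS the mod-3 non-surjective rows

Cell `pub/bsd-wall`, seat `bsd-line-rhp-p1` g5 (LEAD PROVER, LINE mode, line `kolyvagin_split` v3c on the crux L₁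
`Gss2LowerAtThreeRankOne` = stmt-BirchSwinnertonDyer-26021; route rev 9). Helper `--supports` the declared residual
NT = stmt-BirchSwinnertonDyer-27201. THEOREMS ONLY (no definition, no named fact, no `sorry`, no instance). BSD is not
proved by this file and no crux is: it SHRINKS the residual's hypothesis set, nothing more.

## The observation

The residual NT of the rev-9 split of L₁ reads «L₁ on the Gss2 rank-one rows WITHOUT 3-adic tower surjectivity
(`¬ ∀ n, ρ̄_{E,3ⁿ}` onto): the 98 of 355 r1 Gss2 classes with `ρ̄₃` not onto, PLUS any onto-mod-3 class failing higher
up». The second clause is EMPTY, class-wide, in the kernel: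

* the tree's EXOTIC SIGNATURE `ClassX4.exotic_three_of_not_towerSurj_three` (`Additive/X4ExoticThree.lean`, cell
  b2b-bsdres: Hauptmodul `9`-torsion towers, Wuthrich's Lemma 20, the semistable-twist tower, `j ≠ 1728` under surj(3))
  says that an X4 pair at `3` (additive, `E[3]` irreducible) with `ρ̄_{E,3}` onto whose tower FAILS lies in the WILD cell
  `SubW W 3` (`f₃ ≠ 2`);
* Delbourgo's cell (G) at `3` (`SubGord W 3`: `ord₃ j ≥ 0`, `f₃ = 2`, `e ∣ 2`) is TAME (`f₃ = 2`), hence disjoint from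
  `SubW` (`subGord_subTprime_subW_disjoint`); the Gss2 leaf `SubGss W 3 = SubGord W 3 ∧ ¬ TypeGOrd W 3` lies inside (G);
* `ρ̄_{E,3}` onto ⟹ `E[3]` irreducible (`hasIrreducibleModPGaloisRep_of_hasSurjectiveModNGaloisRep`), so additive ∧ surj(3)
  is X4 at `3`.

Hence §1 `towerSurj_three_of_subGord_of_surj` / `towerSurj_three_of_subGss_of_surj` (every `n`), the contrapositive
`not_surj_three_of_subGss_of_not_towerSurj`, and `towerSurj_iff_surj_three_of_subGss`. (Independent second road, not
used: `e ∣ 2` forces `6 ∣ v₃(Δ_min)`, even, so `v₃(j − 1728) = 2v₃(c₆) − v₃(Δ_min) ≠ 3` and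
`ClassX4.towerSurj_three_of_surj_of_padicValRat_j_sub_ne` applies — the route `CyclotomicUntwist` twin
`PSTowerOfEven.towerSurj_three_of_addv_of_surj_of_even`; §1 records `6 ∣ v₃(Δ_min)` on (G) for the census reading
«Gss2 = Kodaira I₀*, v₃(Δ_min) = 6».)

## Consequences for the items (§2–§3, BY NAME)

* §2 NT ⟺ NT₃, where NT₃ := «∀ E non-CM globally minimal, `Addv E 3`, `SubGss E 3`, `r_an = 1`, `ρ̄_{E,3}` NOT onto ⟹
  `MissingLowerBoundAt E 3`» — `gss2LowerAtThreeRankOneNonTower_of_nonSurjThree` / `nonSurjThree_of_gss2LowerAtThreeRankOneNonTower`.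
  RESTATE DATUM for the pen: 27201's text may be replaced by NT₃ (binder `¬ W.HasSurjectiveModNGaloisRep 3` instead of
  `¬ ∀ n, W.HasSurjectiveModNGaloisRep (3 ^ n)`), losslessly; the row set is EXACTLY the `ρ̄₃`-non-onto census classes
  (98 of 355), on which the mod-3 image is irreducible of order prime to `3`.
* §3 L₁ 26021 BY NAME from PUB 27199 ∧ A 27200 ∧ NT₃ — the glue 27202 (p620966) re-read with the smaller residual, the
  case split taken on `ρ̄_{E,3}` onto: `gss2LowerAtThreeRankOne_of_pub_of_certificate_of_nonSurjThree` (Theses-cone-light: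
  only this route's own Theses file and the route-independent McCallum road p618012 are imported).
* The same lemma serves the U-side residuals of this route (26024's «non-tower rows», rhp-p2 lineage) and makes the
  per-class tower certificates of `…StepLIntrinsicTower` (trib-w g9) instances of one class-wide statement.

References: J.-P. Serre, *Abelian ℓ-adic representations* (1968) IV §3.4 Lemma 3 [SerreAbelianLadic1968]; C. Wuthrich,
J. LMS 2014, Lemma 20 [Wuthrich2014]; N. D. Elkies, arXiv:math/0612734 §§1, 4 [Elkies2006]; J.-P. Serre, Invent. Math. 15
(1972) §2 [Serre1972]; W. G. McCallum, in *L-functions and Arithmetic* (1991) §5 [McCallumLMS1991].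
-/

-- D-0017: single-problem summit, so `Summit.BirchSwinnertonDyer.BirchSwinnertonDyer.…` repeats a namespace BY DESIGN.
set_option linter.dupNamespace false
set_option autoImplicit false

noncomputable section

open scoped Classical NumberField

open WeierstrassCurve Literature.NumberTheory.EllipticCurves
  Literature.NumberTheory.EllipticCurves.Rank1Residual
  Literature.NumberTheory.EllipticCurves.Rank1Residual.Typed
  Summit.BirchSwinnertonDyer.Rank1Residual.Additive

namespace Summit.BirchSwinnertonDyer.BirchSwinnertonDyer.Theorems.RamifiedPairLowerBound

/-! ### §1 The 3-adic tower on Delbourgo's cell (G) at `3` -/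

section Tower

variable (W : WeierstrassCurve ℚ) [W.IsElliptic]

/-- `Addv W 3 ∧ Surj W 3` put the pair in class X4 at `3` (`E[3]` is irreducible because `ρ̄_{E,3}` is onto, tree
theorem `hasIrreducibleModPGaloisRep_of_hasSurjectiveModNGaloisRep`). [cite: Serre1972, §2.4 Prop. 15 and §4] -/
theorem classX4_three_of_addv_of_surj_three (hadd : Addv W 3) (hsurj : Surj W 3) : ClassX4 W 3 := by
  haveI : NeZero ((3 : ℕ) : ℚ) := ⟨by norm_num⟩
  exact ⟨by norm_num, hadd, hasIrreducibleModPGaloisRep_of_hasSurjectiveModNGaloisRep W 3 hsurj⟩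

variable [W.IsGloballyMinimal]

/-- **THE 3-ADIC TOWER ON THE CELL (G) AT `3`, UNCONDITIONALLY.** For a globally minimal `E/ℚ` additive at `3` in
Delbourgo's cell (G) (`SubGord E 3`: `ord₃ j ≥ 0`, `f₃ = 2`, `e ∣ 2`) with `ρ̄_{E,3}` onto, `ρ̄_{E,3ⁿ}` is onto for
every `n`: a failing tower with surj(3) at an additive `3` forces the WILD cell `SubW E 3` (`f₃ ≠ 2`, the tree's exotic
signature `ClassX4.exotic_three_of_not_towerSurj_three`), which is disjoint from (G) (`f₃ = 2`). No Frobenius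
certificate, no Elkies moduli sentence, no per-curve valuation.
[cite: SerreAbelianLadic1968, Ch. IV §3.4, Lemma 3 (IV-23)] [cite: Wuthrich2014, Lemma 20 (p. 399)]
[cite: Elkies2006, §1 and §4 (the 9-deficient family has v₃(N) = 5)] -/
theorem towerSurj_three_of_subGord_of_surj (hadd : Addv W 3) (hG : SubGord W 3) (hsurj : Surj W 3) (n : ℕ) :
    W.HasSurjectiveModNGaloisRep (3 ^ n : ℕ) := by
  by_contra hn
  have hnot : ¬ ∀ m : ℕ, W.HasSurjectiveModNGaloisRep (3 ^ m : ℕ) := fun h ↦ hn (h n)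
  have hwild : SubW W 3 :=
    (ClassX4.exotic_three_of_not_towerSurj_three (classX4_three_of_addv_of_surj_three W hadd hsurj) hsurj hnot).1
  exact ((subGord_subTprime_subW_disjoint W 3).1 hG).2 hwild

/-- **The tower on the Gss2 leaf** (`SubGss E 3 = SubGord E 3 ∧ ¬ TypeGOrd E 3`: `e = 2`, Kodaira `I₀*`, `E = V₀ ⊗ χ₋₃`
with `V₀` good supersingular at `3`): additive ∧ Gss2 ∧ surj(3) ⟹ `ρ̄_{E,3ⁿ}` onto for every `n`.
[cite: SerreAbelianLadic1968, Ch. IV §3.4, Lemma 3 (IV-23)] [cite: Wuthrich2014, Lemma 20 (p. 399)] -/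
theorem towerSurj_three_of_subGss_of_surj (hadd : Addv W 3) (hG : SubGss W 3) (hsurj : Surj W 3) (n : ℕ) :
    W.HasSurjectiveModNGaloisRep (3 ^ n : ℕ) :=
  towerSurj_three_of_subGord_of_surj W hadd hG.1 hsurj n

/-- The same on the ordinary half of (G) (`SubGordOrd E 3`), for the record. [cite: Wuthrich2014, Lemma 20 (p. 399)] -/
theorem towerSurj_three_of_subGordOrd_of_surj (hadd : Addv W 3) (hG : SubGordOrd W 3) (hsurj : Surj W 3) (n : ℕ) :
    W.HasSurjectiveModNGaloisRep (3 ^ n : ℕ) :=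
  towerSurj_three_of_subGord_of_surj W hadd hG.1 hsurj n

/-- **Contrapositive on the Gss2 leaf: a NON-TOWER row is a mod-3 NON-SURJECTIVE row.**
[cite: SerreAbelianLadic1968, Ch. IV §3.4, Lemma 3 (IV-23)] [cite: Wuthrich2014, Lemma 20 (p. 399)] -/
theorem not_surj_three_of_subGss_of_not_towerSurj (hadd : Addv W 3) (hG : SubGss W 3)
    (hnot : ¬ ∀ n : ℕ, W.HasSurjectiveModNGaloisRep (3 ^ n : ℕ)) : ¬ Surj W 3 :=
  fun hsurj ↦ hnot (towerSurj_three_of_subGss_of_surj W hadd hG hsurj)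

omit [W.IsElliptic] [W.IsGloballyMinimal] in
/-- The trivial direction: the tower at `n = 1` is surj(3). [folklore] -/
theorem surj_three_of_towerSurj (htower : ∀ n : ℕ, W.HasSurjectiveModNGaloisRep (3 ^ n : ℕ)) : Surj W 3 := by
  have h1 := htower 1
  rw [pow_one] at h1
  exact h1

/-- **On the Gss2 leaf, «3-adic tower row» ⟺ «ρ̄₃ onto».** [cite: Wuthrich2014, Lemma 20 (p. 399)]
[cite: SerreAbelianLadic1968, Ch. IV §3.4, Lemma 3 (IV-23)] -/
theorem towerSurj_iff_surj_three_of_subGss (hadd : Addv W 3) (hG : SubGss W 3) :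
    (∀ n : ℕ, W.HasSurjectiveModNGaloisRep (3 ^ n : ℕ)) ↔ Surj W 3 :=
  ⟨surj_three_of_towerSurj W, towerSurj_three_of_subGss_of_surj W hadd hG⟩

/-- **On (G) at `3`, `6 ∣ v₃(Δ_min)`** (the census's `e = 12 / gcd(12, v₃(Δ_min)) ∣ 2` unfolded: `gcd ∈ {6, 12}`); in
particular `v₃(Δ_min)` is EVEN — the hypothesis of the route-`CyclotomicUntwist` twin
`PSTowerOfEven.towerSurj_three_of_addv_of_surj_of_even` (second, independent road to §1; not used below). [folklore] -/
theorem six_dvd_padicValInt_minimalDiscriminantInt_of_subGord_three (hG : SubGord W 3) :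
    6 ∣ padicValInt 3 W.minimalDiscriminantInt := by
  have he : semistabilityIndex W 3 ∣ 3 - 1 := hG.2.2
  unfold semistabilityIndex at he
  set v := padicValInt 3 W.minimalDiscriminantInt with hv
  have hg12 : Nat.gcd 12 v ∣ 12 := Nat.gcd_dvd_left 12 v
  have hgv : Nat.gcd 12 v ∣ v := Nat.gcd_dvd_right 12 v
  have hle : Nat.gcd 12 v ≤ 12 := Nat.le_of_dvd (by norm_num) hg12
  have hpos : 0 < Nat.gcd 12 v := Nat.gcd_pos_of_pos_left v (by norm_num)
  interval_cases h : Nat.gcd 12 v <;> omega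

/-- … hence `v₃(Δ_min)` is even on (G) at `3`. [folklore] -/
theorem even_padicValInt_minimalDiscriminantInt_of_subGord_three (hG : SubGord W 3) :
    Even (padicValInt 3 W.minimalDiscriminantInt) := by
  obtain ⟨k, hk⟩ := six_dvd_padicValInt_minimalDiscriminantInt_of_subGord_three W hG
  exact ⟨3 * k, by omega⟩

end Tower

/-! ### §2 The declared residual NT (27201) IS the mod-3 non-surjective rows (NT ⟺ NT₃) -/

/-- **NT ⟸ NT₃.** If L₁ (`MissingLowerBoundAt E 3`) holds on every non-CM globally minimal Gss2 rank-one row with `ρ̄_{E,3}`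
NOT onto, then the route's declared residual `Gss2LowerAtThreeRankOneNonTower` (item 27201: the rows without 3-adic
tower surjectivity) holds — a non-tower row is a non-surj(3) row by §1. Pure reduction; books nothing about curves;
BSD is not proved by this. [cite: Wuthrich2014, Lemma 20 (p. 399)] [cite: McCallumLMS1991, §5 Cor. 5.6 (p. 310)] -/
theorem gss2LowerAtThreeRankOneNonTower_of_nonSurjThree
    (h : ∀ (W : WeierstrassCurve ℚ) [W.IsElliptic] [W.IsGloballyMinimal], ¬ W.HasCM → Addv W 3 → SubGss W 3 →
      W.analyticRank = 1 → ¬ W.HasSurjectiveModNGaloisRep 3 → MissingLowerBoundAt W 3) :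
    Summit.BirchSwinnertonDyer.BirchSwinnertonDyer.Theses.RamifiedHeegnerPair.Gss2LowerAtThreeRankOneNonTower := by
  intro W _ _ hCM hadd hsub hr hnot
  exact h W hCM hadd hsub hr (not_surj_three_of_subGss_of_not_towerSurj W hadd hsub hnot)

/-- **NT ⟹ NT₃** (the trivial direction: a non-surj(3) row is a non-tower row at `n = 1`). Together with the previous
theorem: NT ⟺ NT₃ — RESTATE DATUM for item 27201 (replace the binder `¬ ∀ n, ρ̄_{E,3ⁿ} onto` by `¬ ρ̄_{E,3} onto`,
losslessly). [folklore] -/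
theorem nonSurjThree_of_gss2LowerAtThreeRankOneNonTower
    (hNT : Summit.BirchSwinnertonDyer.BirchSwinnertonDyer.Theses.RamifiedHeegnerPair.Gss2LowerAtThreeRankOneNonTower) :
    ∀ (W : WeierstrassCurve ℚ) [W.IsElliptic] [W.IsGloballyMinimal], ¬ W.HasCM → Addv W 3 → SubGss W 3 →
      W.analyticRank = 1 → ¬ W.HasSurjectiveModNGaloisRep 3 → MissingLowerBoundAt W 3 := by
  intro W _ _ hCM hadd hsub hr hns
  exact hNT W hCM hadd hsub hr (fun htower ↦ hns (surj_three_of_towerSurj W htower))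

/-- **NT ⟺ NT₃** packaged as an `Iff`. [folklore] -/
theorem gss2LowerAtThreeRankOneNonTower_iff_nonSurjThree :
    Summit.BirchSwinnertonDyer.BirchSwinnertonDyer.Theses.RamifiedHeegnerPair.Gss2LowerAtThreeRankOneNonTower ↔
    ∀ (W : WeierstrassCurve ℚ) [W.IsElliptic] [W.IsGloballyMinimal], ¬ W.HasCM → Addv W 3 → SubGss W 3 →
      W.analyticRank = 1 → ¬ W.HasSurjectiveModNGaloisRep 3 → MissingLowerBoundAt W 3 :=
  ⟨nonSurjThree_of_gss2LowerAtThreeRankOneNonTower, gss2LowerAtThreeRankOneNonTower_of_nonSurjThree⟩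

/-- The load-bearing crux A (item 27200) quantifies over TOWER rows; on the Gss2 leaf that binder may equally be read as
`ρ̄_{E,3}` onto: A ⟹ the same ∃-statement under the binder `Surj E 3`. [cite: Wuthrich2014, Lemma 20 (p. 399)]
[cite: McCallumLMS1991, §5 Cor. 5.6 (p. 310)] -/
theorem mccallumCertificate_of_surjThree_of_towerItem
    (hA : Summit.BirchSwinnertonDyer.BirchSwinnertonDyer.Theses.RamifiedHeegnerPair.Gss2RankOneMcCallumCertificateAtThreeTower)
    (W : WeierstrassCurve ℚ) [W.IsElliptic] [W.IsGloballyMinimal] (hadd : Addv W 3) (hsub : SubGss W 3)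
    (hr : W.analyticRank = 1) (hsurj : Surj W 3) :
    ∃ (N : ℕ) (_ : NeZero N) (K : Type) (_ : Field K) (_ : NumberField K)
      (Dt : Literature.NumberTheory.EllipticCurves.ModularForms.ModularParametrizationData W N)
      (H : Literature.NumberTheory.EllipticCurves.HeegnerDatum N (NumberField.discr K)) (ι : K →+* ℂ)
      (P : (W.baseChange K).toAffine.Point) (Wd : WeierstrassCurve ℚ) (_ : Wd.IsElliptic) (_ : Wd.IsGloballyMinimal)
      (Cd : WeierstrassCurve.VariableChange ℚ) (M : ℕ), W.conductorNorm ℤ = N ∧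
      Literature.NumberTheory.EllipticCurves.IsImaginaryQuadratic K ∧
      Literature.NumberTheory.EllipticCurves.SatisfiesHeegnerHypothesis N K ∧
      (W.quadraticTwist (NumberField.discr K : ℚ)).entireLFunction 1 ≠ 0 ∧
      WeierstrassCurve.Affine.Point.map ι.toRatAlgHom P =
        Literature.NumberTheory.EllipticCurves.ModularForms.heegnerPointComplex Dt H ∧
      Cd • W.quadraticTwist (NumberField.discr K : ℚ) = Wd ∧
      (2 * M : ℤ) ≤ padicValNat 3 W.tamagawaProduct + padicValNat 3 Wd.tamagawaProduct + 2 * padicValRat 3 (Dt.c : ℚ) ∧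
      Summit.BirchSwinnertonDyer.Rank1Residual.X11b.Three.Koly.CertificateAt Dt H.β ι 3 M :=
  hA W hadd hsub hr (towerSurj_three_of_subGss_of_surj W hadd hsub hsurj)

/-! ### §3 L₁ (26021) BY NAME with the smaller residual -/

/-- **L₁ `Gss2LowerAtThreeRankOne` BY NAME ⟸ PUB (27199) ∧ A (27200) ∧ NT₃** — the glue 27202 (p620966) re-read with
the residual in its mod-3 form, the case split now being ON `ρ̄_{E,3}` ONTO: surj(3) rows by the McCallum-currency road
p618012 §12 `gssLowerAtThree_rankOne_towerRows_of_exists_mccallumCertificate` (the tower binder discharged by §1, the eight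
named facts projected out of PUB), the rest by NT₃. A (= T1⁻ at an additive `3`) and NT₃ remain OPEN hypotheses; PUB is print;
BSD is not proved by this. [cite: McCallumLMS1991, §5 Lemma 5.1 (p. 303) and Cor. 5.6 (p. 310)]
[cite: Kato2004Asterisque, Thm. 14.5 (3) (p. 236)] [cite: Wuthrich2014, Lemma 20 (p. 399)] -/
theorem gss2LowerAtThreeRankOne_of_pub_of_certificate_of_nonSurjThree
    (hP : Summit.BirchSwinnertonDyer.BirchSwinnertonDyer.Theses.RamifiedHeegnerPair.Gss2LowerPrintedInputsAtThree)
    (hA : Summit.BirchSwinnertonDyer.BirchSwinnertonDyer.Theses.RamifiedHeegnerPair.Gss2RankOneMcCallumCertificateAtThreeTower)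
    (hN3 : ∀ (W : WeierstrassCurve ℚ) [W.IsElliptic] [W.IsGloballyMinimal], ¬ W.HasCM → Addv W 3 → SubGss W 3 →
      W.analyticRank = 1 → ¬ W.HasSurjectiveModNGaloisRep 3 → MissingLowerBoundAt W 3) :
    Summit.BirchSwinnertonDyer.BirchSwinnertonDyer.Theses.RamifiedHeegnerPair.Gss2LowerAtThreeRankOne := by
  obtain ⟨⟨hGZ, hKo, -, hGZK, hmod, -, -, hrec, hMc, h36⟩, hKatoT⟩ := hP
  intro W _ _ hCM hadd hsub hr
  by_cases hsurj : Surj W 3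
  · exact gssLowerAtThree_rankOne_towerRows_of_exists_mccallumCertificate hGZ hKo hKatoT hGZK hmod hrec h36 hMc hA W hadd
      hsub hr (towerSurj_three_of_subGss_of_surj W hadd hsub hsurj)
  · exact hN3 W hCM hadd hsub hr hsurj

/-- **Pointwise form on a surj(3) row**: PUB's eight consumed facts ∧ ONE McCallum certificate of adjusted BSD depth at a
split Heegner frame ⟹ L₁(E), for a Gss2 rank-one `E` with `ρ̄_{E,3}` onto (the tower binder of p618012 §12 discharged by
§1). [cite: McCallumLMS1991, §5 Lemma 5.1 (p. 303) and Cor. 5.6 (p. 310)] [cite: Kato2004Asterisque, Thm. 14.5 (3) (p. 236)] -/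
theorem missingLowerBoundAt_three_of_pub_of_certificate_of_surjThree
    (hP : Summit.BirchSwinnertonDyer.BirchSwinnertonDyer.Theses.RamifiedHeegnerPair.Gss2LowerPrintedInputsAtThree)
    (hA : Summit.BirchSwinnertonDyer.BirchSwinnertonDyer.Theses.RamifiedHeegnerPair.Gss2RankOneMcCallumCertificateAtThreeTower)
    (W : WeierstrassCurve ℚ) [W.IsElliptic] [W.IsGloballyMinimal] (hadd : Addv W 3) (hsub : SubGss W 3)
    (hr : W.analyticRank = 1) (hsurj : Surj W 3) : MissingLowerBoundAt W 3 := by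
  obtain ⟨⟨hGZ, hKo, -, hGZK, hmod, -, -, hrec, hMc, h36⟩, hKatoT⟩ := hP
  exact gssLowerAtThree_rankOne_towerRows_of_exists_mccallumCertificate hGZ hKo hKatoT hGZK hmod hrec h36 hMc hA W hadd
    hsub hr (towerSurj_three_of_subGss_of_surj W hadd hsub hsurj)

/-! ### §4 (APPEND, rhp-p1 g5) The residual's rows EXACTLY: `E[3]` irreducible, mod-3 image `= C_ns⁺(3)`, inside the
big-image barrier; on the Gss2 leaf `KatoBigImageHypothesis E 3 ⟺ ρ̄_{E,3} onto ⟺ the 3-adic tower`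

Everything below is a one-line reading, on the Gss2 leaf at `p = 3`, of theorems already in the tree (cells b2b-bsdres / n1011:
`Additive/LocIrrOddPrimes`, `O5/GssTwistDictionary`, `GaloisImage/SupersingularTwistExactImage`, `GaloisImage/SmallImageInertiaOrder`,
and the barrier `Literature/Barriers/BirchSwinnertonDyer/EulerSystemBigImageAtSmallImage`). What it buys for the planner: the rows
of NT₃ (= NT 27201 by §2) are precisely the Gss2 rank-one rows whose mod-3 image is the FULL normaliser of a non-split Cartan
subgroup (`HasModPImageEqNonsplitCartanNormalizer E 3`, label `3Nn`, order 16, prime to 3): `E[3]` is irreducible there, no member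
of the technique class «Kato (12.5.2) / p-adic surjectivity / the σ-hypothesis» is instantiable there (the catalogued barrier
`EulerSystemBigImageBarrier`), and conversely on the surj(3) rows of the leaf the hypothesis HOLDS (the tower of §1) — so the split
27200 (A, surj(3) rows) / 27201 (NT, `3Nn` rows) of L₁ is EXACTLY the split «inside / outside the big-image technique class».
Nothing here is progress on L₁; BSD is not proved by any of it. -/

section Residual

variable (W : WeierstrassCurve ℚ) [W.IsElliptic] [W.IsGloballyMinimal]

/-- **`E[3]` is irreducible on the Gss2 leaf** (additive `I₀*`-supersingular at `3`: a `−3`-twist of a good supersingular curve,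
locally irreducible at `3`; tree `irr_of_subGss_of_ne_two`). [cite: Serre1972, §1.11 Prop. 12] -/
theorem irr_three_of_subGss (hadd : Addv W 3) (hG : SubGss W 3) : Irr W 3 :=
  irr_of_subGss_of_ne_two W 3 (by norm_num) hadd hG

/-- The Gss2 leaf at `3` lies in class X4 (additive, `E[3]` irreducible). [cite: Serre1972, §1.11 Prop. 12] -/
theorem classX4_three_of_subGss (hadd : Addv W 3) (hG : SubGss W 3) : ClassX4 W 3 :=
  classX4_of_subGss_of_ne_two W 3 (by norm_num) hadd hG

/-- **On a Gss2 row with `ρ̄_{E,3}` NOT onto the mod-3 image is EXACTLY the normaliser of a non-split Cartan subgroup**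
(`3Nn`, order 16): `E` is the `−3`-twist of a good supersingular curve (`O5.exists_goodSS_twist_pStar_of_subGss`), whose
image at a non-surjective supersingular `3` is `C_ns⁺(3)` exactly (`GaloisImage.hasModPImageEqNonsplitCartanNormalizer_of_goodSS_twist_of_not_surj`,
frame transport along `E[3] ≃ E^{(−3)}[3] ⊗ χ₋₃`). [cite: Serre1972, §1.11 Prop. 12 and §2.2] [cite: SilvermanAEC2009, X.5 Cor. 5.4] -/
theorem hasModPImageEqNonsplitCartanNormalizer_three_of_subGss_of_not_surj (hadd : Addv W 3) (hG : SubGss W 3)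
    (hns : ¬ Surj W 3) : Literature.NumberTheory.SerreUniformity.HasModPImageEqNonsplitCartanNormalizer W 3 := by
  obtain ⟨Wd, hE, hM, C, hC, hss⟩ :=
    Summit.BirchSwinnertonDyer.Rank1Residual.O5.exists_goodSS_twist_pStar_of_subGss W 3 (by norm_num) hadd hG
  exact Summit.BirchSwinnertonDyer.Rank1Residual.GaloisImage.hasModPImageEqNonsplitCartanNormalizer_of_goodSS_twist_of_not_surj
    W 3 (by norm_num) (Summit.BirchSwinnertonDyer.Rank1Residual.O5.pStar_ne_zero 3) Wd ⟨C, hC⟩ hss hns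

/-- **Dichotomy on the Gss2 leaf at `3`: `ρ̄_{E,3}` onto, or image `= C_ns⁺(3)` exactly** (no third case: no Borel, no `C_ns`
alone, no exceptional image). [cite: Serre1972, §2.2 and §2.4 Prop. 15] -/
theorem surj_or_hasModPImageEqNonsplitCartanNormalizer_three_of_subGss (hadd : Addv W 3) (hG : SubGss W 3) :
    Surj W 3 ∨ Literature.NumberTheory.SerreUniformity.HasModPImageEqNonsplitCartanNormalizer W 3 := by
  by_cases hs : Surj W 3
  · exact Or.inl hs
  · exact Or.inr (hasModPImageEqNonsplitCartanNormalizer_three_of_subGss_of_not_surj W hadd hG hs)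

omit [W.IsElliptic] [W.IsGloballyMinimal] in
/-- An image inside `C_ns⁺(3)` is not all of `Aut E[3]` (tree `not_hasSurjectiveModNGaloisRep_of_hasNonsplitCartanModPImage`:
`C_ns⁺` contains no unipotent). [folklore] -/
theorem not_surj_three_of_hasModPImageEqNonsplitCartanNormalizer
    (h : Literature.NumberTheory.SerreUniformity.HasModPImageEqNonsplitCartanNormalizer W 3) : ¬ Surj W 3 :=
  Literature.NumberTheory.SerreUniformity.not_hasSurjectiveModNGaloisRep_of_hasNonsplitCartanModPImage W
    h.hasNonsplitCartanModPImage

/-- **On a Gss2 row with `ρ̄_{E,3}` not onto, `3 ∤ #ρ̄_{E,3}(H)` for every `H ≤ Γ_ℚ`** (tame image; tree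
`O8.not_dvd_card_map_galoisRepTorsion`). [cite: Serre1972, §2.4 Prop. 15] -/
theorem not_three_dvd_card_map_galoisRepTorsion_of_subGss_of_not_surj (hadd : Addv W 3) (hG : SubGss W 3)
    (hns : ¬ Surj W 3) (H : Subgroup (Field.absoluteGaloisGroup ℚ)) :
    ¬ 3 ∣ Nat.card (H.map (galoisRepTorsion W 3)) :=
  O8.not_dvd_card_map_galoisRepTorsion W 3 (classX4_three_of_subGss W hadd hG) hns H

/-- **NT₃ rows are INSIDE the catalogued barrier `EulerSystemBigImageBarrier`**: on a Gss2 row with `ρ̄_{E,3}` not onto,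
`¬ KatoBigImageHypothesis E 3` — neither Kato's (12.5.2), nor 3-adic surjectivity, nor the σ-hypothesis (im) holds, so no
printed theorem of that technique class is instantiable BY NAME there.
[cite: Kato2004Asterisque, (12.5.2) in Thm. 12.5 (4) (p. 222) and Thm. 13.4 (3) (p. 226)] [cite: Serre1972, §2.4 Prop. 15] -/
theorem not_katoBigImageHypothesis_three_of_subGss_of_not_surj (hadd : Addv W 3) (hG : SubGss W 3) (hns : ¬ Surj W 3) :
    ¬ Literature.Barriers.BirchSwinnertonDyer.KatoBigImageHypothesis W 3 :=
  Literature.Barriers.BirchSwinnertonDyer.not_katoBigImageHypothesis_of_classX4_of_not_surj W 3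
    (classX4_three_of_subGss W hadd hG) hns

/-- **… and the surj(3) rows of the leaf are INSIDE the technique class**: `ρ̄_{E,3}` onto ⟹ `KatoBigImageHypothesis E 3`
(its 3-adic-surjectivity disjunct, by the tower of §1). [cite: Wuthrich2014, Lemma 20 (p. 399)]
[cite: Sprung2012, Thm. 7.16 and Thm. 7.18 (p. 1504)] -/
theorem katoBigImageHypothesis_three_of_subGss_of_surj (hadd : Addv W 3) (hG : SubGss W 3) (hsurj : Surj W 3) :
    Literature.Barriers.BirchSwinnertonDyer.KatoBigImageHypothesis W 3 :=
  Literature.Barriers.BirchSwinnertonDyer.katoBigImageHypothesis_of_forall_hasSurjectiveModNGaloisRep W 3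
    (towerSurj_three_of_subGss_of_surj W hadd hG hsurj)

/-- **On the Gss2 leaf at `3`, the big-image hypothesis of the Euler-system/IMC technique class is EQUIVALENT to `ρ̄_{E,3}`
onto** — the additive-`I₀*` twin of the barrier file's `katoBigImageHypothesis_iff_surj_of_classX8` (good supersingular `3`).
So the rev-9 split of L₁ into A 27200 (tower = surj(3) rows) and NT 27201 (= NT₃, the `3Nn` rows) is EXACTLY the split
«inside / outside the big-image technique class». [cite: Wuthrich2014, Lemma 20 (p. 399)] [cite: Serre1972, §2.4 Prop. 15]
[cite: Kato2004Asterisque, (12.5.2) in Thm. 12.5 (4) (p. 222)] -/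
theorem katoBigImageHypothesis_iff_surj_three_of_subGss (hadd : Addv W 3) (hG : SubGss W 3) :
    Literature.Barriers.BirchSwinnertonDyer.KatoBigImageHypothesis W 3 ↔ Surj W 3 :=
  ⟨fun h ↦ by
    by_contra hns
    exact not_katoBigImageHypothesis_three_of_subGss_of_not_surj W hadd hG hns h,
   katoBigImageHypothesis_three_of_subGss_of_surj W hadd hG⟩

end Residual

/-- **NT 27201 ⟸ L₁ on the `3Nn` rows**: if `MissingLowerBoundAt E 3` holds for every non-CM globally minimal Gss2 rank-one `E`
whose mod-3 image is EXACTLY the normaliser of a non-split Cartan subgroup, the declared residual holds (§2 + the exact image of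
§4). This is the residual's sharpest row description in the tree's Serre-uniformity vocabulary. Pure reduction; BSD is not
proved by this. [cite: Serre1972, §2.2] [cite: McCallumLMS1991, §5 Cor. 5.6 (p. 310)] -/
theorem gss2LowerAtThreeRankOneNonTower_of_nonsplitCartanNormalizerRows
    (h : ∀ (W : WeierstrassCurve ℚ) [W.IsElliptic] [W.IsGloballyMinimal], ¬ W.HasCM → Addv W 3 → SubGss W 3 →
      W.analyticRank = 1 → Literature.NumberTheory.SerreUniformity.HasModPImageEqNonsplitCartanNormalizer W 3 →
      MissingLowerBoundAt W 3) :
    Summit.BirchSwinnertonDyer.BirchSwinnertonDyer.Theses.RamifiedHeegnerPair.Gss2LowerAtThreeRankOneNonTower :=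
  gss2LowerAtThreeRankOneNonTower_of_nonSurjThree fun W _ _ hCM hadd hsub hr hns ↦
    h W hCM hadd hsub hr (hasModPImageEqNonsplitCartanNormalizer_three_of_subGss_of_not_surj W hadd hsub hns)

/-- **… and conversely** (a `3Nn` row is a non-surj(3) row): NT ⟺ «L₁ on the `3Nn` rows of the Gss2 rank-one leaf».
[cite: Serre1972, §2.2] -/
theorem nonsplitCartanNormalizerRows_of_gss2LowerAtThreeRankOneNonTower
    (hNT : Summit.BirchSwinnertonDyer.BirchSwinnertonDyer.Theses.RamifiedHeegnerPair.Gss2LowerAtThreeRankOneNonTower) :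
    ∀ (W : WeierstrassCurve ℚ) [W.IsElliptic] [W.IsGloballyMinimal], ¬ W.HasCM → Addv W 3 → SubGss W 3 →
      W.analyticRank = 1 → Literature.NumberTheory.SerreUniformity.HasModPImageEqNonsplitCartanNormalizer W 3 →
      MissingLowerBoundAt W 3 :=
  fun W _ _ hCM hadd hsub hr himg ↦ nonSurjThree_of_gss2LowerAtThreeRankOneNonTower hNT W hCM hadd hsub hr
    (not_surj_three_of_hasModPImageEqNonsplitCartanNormalizer W himg)

end Summit.BirchSwinnertonDyer.BirchSwinnertonDyer.Theorems.RamifiedPairLowerBound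

end
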